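import Literature.Analysis.FluidPDE.FluidComputer.ThresholdDrainGluing
import Literature.Analysis.FluidPDE.FluidComputer.DrainOverdamped
import Literature.Analysis.FluidPDE.FluidComputer.SelfDampingRotor
import HarnessLib

/-!
# Fluid computer blueprint — threshold gate: drain conversion on a window, given the clock side

HONEST FRAMING: low prior, high value-of-information experiment on Tao's machine paradigm; NOT a
claim that NS blows up. Elementary estimates on forced windows of the explicit five-mode
threshold circuit `thresholdCircuit` (`ThresholdGate.lean`); nothing is asserted about any fluid
equation, and the transfer stage as a `ReachCertificate` remains OPEN (its clock side).

## What

The gate-level analogue of the toy theorem `SelfDampingRotor.IsTrajectory.conversion`: on a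
forced window (`IsForcedWindow ε σ ν μ r κ δ τ x`, modes `x t = (a, b, c, d, ã)`) along which the
CLOCK SIDE holds — the trigger stays in a band `c₀ ≤ c ≤ Cm` (`c₀ > 0`), every mode is `≤ R` in
absolute value, the clock is `≤ B` in absolute value, the output is `≥ 0`, and the rotor angle `Θ`
(`Θ(0) = 0`, `∂ₜΘ = r·c`) stays `≤ ΘM` — the drain CONVERTS: once the rotor has turned by
`Θ(t) ≥ r·Cm·T_A + Θ_d`, the unconverted pair energy obeys

  `(1 - β/2)(a(t)² + d(t)²) ≤ exp(-λΘ_d)·((1 + β/2)(E(0) + 10RδT) + 8R·P·exp(λΘM)·T)`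

(`IsForcedWindow.pair_energy_le_of_angle`; `P = εR² + σRCm + μCm² + δ`, any `0 ≤ λ ≤ β/4`), hence
the output carries `ã(t)² ≥ E(0) - 10RδT - B² - Cm² - [that bound]/(1 - β/2)`
(`IsForcedWindow.output_sq_ge_of_angle`; `T ≥ τ` is any budget horizon). Here `T_A` is any
build-up horizon whose budget reaches the level `L` (`β·r·Cm + κδT ≤ L ≤ r·c₀`, the
hypothesis `hreach`, exactly the one of `IsForcedWindow.exists_output_level` with weak-band
ceiling `γ₁ = 1` and pair-energy floor `u₀ ≤ E(0) - 10RδT - B² - Cm² - (L/κ)²`), and `β` is the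
band floor of the conversion phase, which runs in the OVERDAMPED band `[β, 2/β]` of
`DrainOverdamped.lean` (band ceiling from `βκR ≤ 2rc₀`).

The chain (all landed lemmas): `exists_output_level` (in the form
`exists_output_level_of_floor_below`: the pair-energy floor is only needed WHILE the output is
below the level, where it is energy bookkeeping, `pairEnergy_floor`) → `band_floor_of_level` →
`shift` (restart at the level time `t₁ ≤ T_A`, angle `Θ(t₁ + ·) - Θ(t₁)`) →
`pair_energy_decay_overdamped` (this file: the window instantiation of
`DampedRotor.energy_decay_time_overdamped`, as `pair_energy_decay[_sharp]` instantiate the other two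
rungs) → energy bookkeeping (`energy_abs_sub_le`); `angle_le_mul` / `angle_mono` place `t₁` before
any time of angle `> r·Cm·T_A`.

What remains for the transfer stage (HOME/pub-fluidc-bp3/NEXT-STAGES.md): the CLOCK SIDE itself —
that `c₀ ≤ c ≤ Cm`, `|b| ≤ B`, `ã ≥ 0` survive until the angle `r·Cm·T_A + Θ_d` is reached
(`trigger_le_angle`, `rate_ge_angle`, `conduit_floor` are its bricks) — and the final-stage
`ReachCertificate` over the energy ball.
[cite: Tao2016AveragedNS, §5.5 Thm 5.3 (5.5) (third window: energy transfer)]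
-/

noncomputable section

open Set Filter Topology
open scoped NNReal

namespace Literature.Analysis.FluidPDE.FluidComputer

open Literature.Analysis.FluidPDE.Tao2016AveragedNS Literature.Analysis.ODE

variable {ε σ ν μ r κ δ τ : ℝ} {x : ℝ → Fin 5 → ℝ} {Θ : ℝ → ℝ}

namespace IsForcedWindow

/-- **The angle grows at most at the trigger ceiling's rate**: while `c ≤ Cm` on `[0, τ)` (`r ≥ 0`),
`Θ(t) ≤ r·Cm·t`. [folklore] -/
theorem angle_le_mul (hr : 0 ≤ r) {Cm : ℝ} (hΘ0 : Θ 0 = 0) (hΘc : ContinuousOn Θ (Icc 0 τ))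
    (hΘ' : ∀ t ∈ Ico 0 τ, HasDerivWithinAt Θ (r * x t 2) (Ici t) t)
    (hc : ∀ t ∈ Ico 0 τ, x t 2 ≤ Cm) : ∀ t ∈ Icc 0 τ, Θ t ≤ r * Cm * t := by
  intro t ht
  have := sub_le_mul_of_deriv_right_le (M := r * Cm) (f' := fun s => r * x s 2) hΘc hΘ'
    (fun s hs => mul_le_mul_of_nonneg_left (hc s hs) hr) t ht
  simp only [hΘ0, sub_zero] at this
  linarith

/-- **The angle is monotone** while `c ≥ 0` on `[0, τ)` (`r ≥ 0`). [folklore] -/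
theorem angle_mono (hr : 0 ≤ r) (hΘc : ContinuousOn Θ (Icc 0 τ))
    (hΘ' : ∀ t ∈ Ico 0 τ, HasDerivWithinAt Θ (r * x t 2) (Ici t) t)
    (hc : ∀ t ∈ Ico 0 τ, 0 ≤ x t 2) {s t : ℝ} (hs : 0 ≤ s) (hst : s ≤ t) (ht : t ≤ τ) :
    Θ s ≤ Θ t :=
  le_of_deriv_right_nonneg (f' := fun u => r * x u 2) (hΘc.mono (Icc_subset_Icc_left hs))
    (fun u hu => hΘ' u ⟨hs.trans hu.1, hu.2⟩)
    (fun u hu => mul_nonneg hr (hc u ⟨hs.trans hu.1, hu.2⟩)) t ⟨hst, ht⟩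

/-- **Overdamped pair-energy decay on a forced window** (instantiation of
`DampedRotor.energy_decay_time_overdamped`): in the band `β·rc ≤ κã`, `β·κã ≤ 2·rc`
(`0 < β ≤ 1`), with `0 ≤ c ≤ Cm`, `|xᵢ| ≤ R`, `Θ ≤ ΘM` on the window and any rate `0 ≤ λ ≤ β/4`:
`(1 - β/2)(a(t)² + d(t)²) ≤ exp(-λΘ(t))·((1 + β/2)(a(0)² + d(0)²) + 8R·P·exp(λΘM)·t)`,
`P = εR² + σRCm + μCm² + δ`. [folklore] -/
theorem pair_energy_decay_overdamped (h : IsForcedWindow ε σ ν μ r κ δ τ x) (hε : 0 ≤ ε)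
    (hσ : 0 ≤ σ) (hμ : 0 ≤ μ) (hr : 0 ≤ r) (hδ : 0 ≤ δ) {R Cm β lam ΘM : ℝ} (hR : 0 ≤ R)
    (hCm : 0 ≤ Cm) (hβ0 : 0 < β) (hβ1 : β ≤ 1) (hlam0 : 0 ≤ lam) (hlam : lam ≤ β / 4)
    (hΘ0 : Θ 0 = 0) (hΘc : ContinuousOn Θ (Icc 0 τ))
    (hΘ' : ∀ t ∈ Ico 0 τ, HasDerivWithinAt Θ (r * x t 2) (Ici t) t)
    (hΘM : ∀ t ∈ Icc 0 τ, Θ t ≤ ΘM) (hc : ∀ t ∈ Ico 0 τ, 0 ≤ x t 2 ∧ x t 2 ≤ Cm)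
    (hRall : ∀ t ∈ Ico 0 τ, ∀ i, |x t i| ≤ R)
    (hband : ∀ t ∈ Ico 0 τ,
      β * (r * x t 2) ≤ κ * x t 4 ∧ β * (κ * x t 4) ≤ 2 * (r * x t 2)) :
    ∀ t ∈ Icc 0 τ, (1 - β / 2) * (x t 0 ^ 2 + x t 3 ^ 2) ≤
      Real.exp (-lam * Θ t) * ((1 + β / 2) * (x 0 0 ^ 2 + x 0 3 ^ 2) +
        8 * R * (ε * R ^ 2 + σ * R * Cm + μ * Cm ^ 2 + δ) * Real.exp (lam * ΘM) * t) := by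
  choose! V hV hVδ using h.defect
  have hP : 0 ≤ ε * R ^ 2 + σ * R * Cm + μ * Cm ^ 2 + δ := by positivity
  refine DampedRotor.energy_decay_time_overdamped (a := fun t => x t 0) (d := fun t => x t 3)
    (a' := fun t => V t 0) (d' := fun t => V t 3) (ω := fun t => r * x t 2)
    (g := fun t => κ * x t 4) (Θ := Θ)
    ((continuous_apply 0).comp_continuousOn h.continuousOn)
    ((continuous_apply 3).comp_continuousOn h.continuousOn)
    (fun s hs => (hasDerivWithinAt_pi.1 (hV s hs)) 0)
    (fun s hs => (hasDerivWithinAt_pi.1 (hV s hs)) 3) hΘc hΘ0 hΘ' hΘM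
    (fun s hs => mul_nonneg hr (hc s hs).1) hβ0 hβ1 hlam0 hlam hband hR hP
    (fun s hs => ⟨hRall s hs 0, hRall s hs 3⟩) (fun s hs => ?_) (fun s hs => ?_)
  · -- `|a' + ωd| = |-εab - σac + μc² + g_a| ≤ P`
    have hg := abs_apply_le_of_norm_le (hVδ s hs) 0
    rw [Pi.sub_apply, thresholdCircuit_apply_zero] at hg
    obtain ⟨hc0, hcC⟩ := hc s hs
    have hab : |x s 0 * x s 1| ≤ R * R := by
      rw [abs_mul]; exact mul_le_mul (hRall s hs 0) (hRall s hs 1) (abs_nonneg _) hR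
    have hac : |x s 0 * x s 2| ≤ R * Cm := by
      rw [abs_mul, abs_of_nonneg hc0]
      exact mul_le_mul (hRall s hs 0) hcC hc0 hR
    have hcc : x s 2 ^ 2 ≤ Cm ^ 2 := pow_le_pow_left₀ hc0 hcC 2
    have e : V s 0 + r * x s 2 * x s 3 =
        (V s 0 - (-(ε * x s 0 * x s 1) - σ * x s 0 * x s 2 + μ * x s 2 ^ 2 - r * x s 3 * x s 2)) +
        (-(ε * (x s 0 * x s 1)) - σ * (x s 0 * x s 2) + μ * x s 2 ^ 2) := by ring
    rw [e]
    have h1 := abs_le.1 hab; have h2 := abs_le.1 hac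
    refine (abs_add_le _ _).trans ?_
    have h3 : |-(ε * (x s 0 * x s 1)) - σ * (x s 0 * x s 2) + μ * x s 2 ^ 2| ≤
        ε * R ^ 2 + σ * R * Cm + μ * Cm ^ 2 := by
      rw [abs_le]; constructor <;> nlinarith [h1.1, h1.2, h2.1, h2.2, hcc, sq_nonneg (x s 2),
        mul_nonneg hμ (sq_nonneg (x s 2))]
    linarith [hg, h3]
  · -- `|d' - (ωa - gd)| = |g_d| ≤ δ ≤ P`
    have hg := abs_apply_le_of_norm_le (hVδ s hs) 3
    rw [Pi.sub_apply, thresholdCircuit_apply_three] at hg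
    have e : V s 3 - (r * x s 2 * x s 0 - κ * x s 4 * x s 3) =
        V s 3 - (r * x s 0 * x s 2 - κ * x s 3 * x s 4) := by ring
    rw [e]
    have : 0 ≤ ε * R ^ 2 + σ * R * Cm + μ * Cm ^ 2 := by positivity
    linarith [hg]

/-- **The build-up ends — with the pair-energy floor needed only below the level.** As
`exists_output_level`, but the floor `a² + d² ≥ u₀` is asked only at times where `κã < L` (where it
is energy bookkeeping: `pairEnergy_floor`). [folklore] -/
theorem exists_output_level_of_floor_below (h : IsForcedWindow ε σ ν μ r κ δ τ x) (hε : 0 ≤ ε)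
    (hσ : 0 ≤ σ) (hμ : 0 ≤ μ) (hr : 0 < r) (hκ : 0 ≤ κ) (hδ : 0 ≤ δ)
    {R Cm c₀ γ₁ u₀ L TA : ℝ} (hR : 0 ≤ R) (hCm : 0 < Cm) (hc₀ : 0 ≤ c₀) (hγ₁0 : 0 ≤ γ₁)
    (hγ₁ : γ₁ ≤ 2) (hu₀ : 0 ≤ u₀) (hΘ0 : Θ 0 = 0) (hΘc : ContinuousOn Θ (Icc 0 τ))
    (hΘ' : ∀ t ∈ Ico 0 τ, HasDerivWithinAt Θ (r * x t 2) (Ici t) t)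
    (hc : ∀ t ∈ Ico 0 τ, c₀ ≤ x t 2 ∧ x t 2 ≤ Cm) (hRall : ∀ t ∈ Icc 0 τ, ∀ i, |x t i| ≤ R)
    (hu : ∀ t ∈ Ico 0 τ, κ * x t 4 < L → u₀ ≤ x t 0 ^ 2 + x t 3 ^ 2)
    (hout : ∀ t ∈ Ico 0 τ, 0 ≤ κ * x t 4) (hLceil : L ≤ γ₁ * (r * c₀)) (hTA : TA ∈ Icc 0 τ)
    (hreach : L ≤ κ * (x 0 4 - κ / (r * Cm) * R ^ 2 +
      κ / (r * Cm) / 2 * ((1 - γ₁ / 2) * u₀) * (r * c₀ * TA) -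
      (κ / (r * Cm) * R * (ε * R ^ 2 + σ * R * Cm + μ * Cm ^ 2 + δ) + δ) * TA)) :
    ∃ t₁ ∈ Icc 0 TA, L ≤ κ * x t₁ 4 := by
  by_contra hcon
  simp only [not_exists, not_and, not_le] at hcon
  have hW := h.mono hTA.2
  have hIco : ∀ t ∈ Ico 0 TA, t ∈ Ico 0 τ := fun t ht => ⟨ht.1, lt_of_lt_of_le ht.2 hTA.2⟩
  have hIcc : ∀ t ∈ Icc 0 TA, t ∈ Icc 0 τ := fun t ht => ⟨ht.1, ht.2.trans hTA.2⟩
  obtain ⟨t₁, ht₁, hL⟩ := hW.exists_output_level hε hσ hμ hr hκ hδ hR hCm hc₀ hγ₁0 hγ₁ hu₀ hΘ0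
    (hΘc.mono (Icc_subset_Icc_right hTA.2)) (fun t ht => hΘ' t (hIco t ht))
    (fun t ht => hc t (hIco t ht)) (fun t ht => hRall t (hIcc t ht))
    (fun t ht => hu t (hIco t ht) (hcon t (Ico_subset_Icc_self ht)))
    (fun t ht => hout t (hIco t ht)) hLceil ⟨hTA.1, le_rfl⟩ hreach
  exact absurd hL (not_le.2 (hcon t₁ ht₁))

set_option maxHeartbeats 400000 in
/-- **Drain conversion on a forced window, given the clock side** (see the module docstring).
Hypotheses, in order: signs of the couplings; the constants; the angle `Θ`; the CLOCK SIDE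
(`c₀ ≤ c ≤ Cm`, `|xᵢ| ≤ R`, `|b| ≤ B`, `ã ≥ 0`, `Θ ≤ ΘM`); the level `L` between the band floor
`β·r·Cm + κδT` and the weak ceiling `r·c₀` (`T ≥ τ` a budget horizon); the overdamped band
ceiling `βκR ≤ 2rc₀`; the build-up floor `u₀`; the build-up horizon `T_A` with its budget
`hreach`. Conclusion: past the angle `r·Cm·T_A + Θ_d` the pair energy has decayed by `exp(-λΘ_d)`
up to the forcing. [folklore] -/
theorem pair_energy_le_of_angle (h : IsForcedWindow ε σ ν μ r κ δ τ x) (hε : 0 ≤ ε) (hσ : 0 ≤ σ)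
    (hμ : 0 ≤ μ) (hr : 0 < r) (hκ : 0 < κ) (hδ : 0 ≤ δ)
    {R B Cm c₀ β lam ΘM u₀ L TA Θd T : ℝ} (hR : 0 ≤ R) (hCm : 0 < Cm)
    (hc₀ : 0 < c₀) (hβ0 : 0 < β) (hβ1 : β ≤ 1) (hlam0 : 0 ≤ lam) (hlam : lam ≤ β / 4)
    (hu₀ : 0 ≤ u₀) (hΘd : 0 < Θd) (hτT : τ ≤ T) (hΘ0 : Θ 0 = 0) (hΘc : ContinuousOn Θ (Icc 0 τ))
    (hΘ' : ∀ t ∈ Ico 0 τ, HasDerivWithinAt Θ (r * x t 2) (Ici t) t)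
    (hΘM : ∀ t ∈ Icc 0 τ, Θ t ≤ ΘM)
    (hc : ∀ t ∈ Ico 0 τ, c₀ ≤ x t 2 ∧ x t 2 ≤ Cm) (hRall : ∀ t ∈ Icc 0 τ, ∀ i, |x t i| ≤ R)
    (hBall : ∀ t ∈ Ico 0 τ, |x t 1| ≤ B) (hout : ∀ t ∈ Ico 0 τ, 0 ≤ x t 4)
    (hLfloor : β * (r * Cm) + κ * δ * T ≤ L) (hLceil : L ≤ r * c₀)
    (hceil : β * (κ * R) ≤ 2 * (r * c₀))
    (hu₀E : u₀ ≤ energy (x 0) - 10 * (δ * R) * T - B ^ 2 - Cm ^ 2 - (L / κ) ^ 2)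
    (hTA : TA ∈ Icc 0 τ)
    (hreach : L ≤ κ * (x 0 4 - κ / (r * Cm) * R ^ 2 +
      κ / (r * Cm) / 2 * ((1 - 1 / 2) * u₀) * (r * c₀ * TA) -
      (κ / (r * Cm) * R * (ε * R ^ 2 + σ * R * Cm + μ * Cm ^ 2 + δ) + δ) * TA)) :
    ∀ t ∈ Icc 0 τ, r * Cm * TA + Θd ≤ Θ t →
      (1 - β / 2) * (x t 0 ^ 2 + x t 3 ^ 2) ≤
        Real.exp (-lam * Θd) * ((1 + β / 2) * (energy (x 0) + 10 * (δ * R) * T) +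
          8 * R * (ε * R ^ 2 + σ * R * Cm + μ * Cm ^ 2 + δ) * Real.exp (lam * ΘM) * T) := by
  have hIcoIcc : ∀ t ∈ Ico 0 τ, t ∈ Icc 0 τ := fun t ht => Ico_subset_Icc_self ht
  have hκ0 : 0 ≤ κ := hκ.le
  have hP : 0 ≤ ε * R ^ 2 + σ * R * Cm + μ * Cm ^ 2 + δ := by positivity
  -- Step 1: the output reaches the level `L` at some `t₁ ≤ T_A`
  have hu : ∀ t ∈ Ico 0 τ, κ * x t 4 < L → u₀ ≤ x t 0 ^ 2 + x t 3 ^ 2 := by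
    intro t ht hlt
    have hfl := h.pairEnergy_floor hR (fun s hs => hRall s (hIcoIcc s hs)) t (hIcoIcc t ht)
    have hb2 : x t 1 ^ 2 ≤ B ^ 2 := by
      have hb := abs_le.1 (hBall t ht); exact sq_le_sq' hb.1 hb.2
    have hc2 : x t 2 ^ 2 ≤ Cm ^ 2 := by
      obtain ⟨h0, h1⟩ := hc t ht
      exact pow_le_pow_left₀ (hc₀.le.trans h0) h1 2
    have he2 : x t 4 ^ 2 ≤ (L / κ) ^ 2 := by
      have h0 := hout t ht
      have h1 : x t 4 ≤ L / κ := by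
        rw [le_div_iff₀ hκ]; nlinarith [hlt]
      exact pow_le_pow_left₀ h0 h1 2
    have hdr : 10 * (δ * R) * t ≤ 10 * (δ * R) * T :=
      mul_le_mul_of_nonneg_left (ht.2.le.trans hτT) (by positivity)
    linarith
  obtain ⟨t₁, ht₁A, hL⟩ := h.exists_output_level_of_floor_below hε hσ hμ hr hκ0 hδ (γ₁ := 1)
    hR hCm hc₀.le zero_le_one (by norm_num) hu₀ hΘ0 hΘc hΘ' hc hRall hu
    (fun t ht => mul_nonneg hκ0 (hout t ht)) (by rw [one_mul]; exact hLceil) hTA hreach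
  have ht₁ : t₁ ∈ Icc 0 τ := ⟨ht₁A.1, ht₁A.2.trans hTA.2⟩
  -- Step 2: the level keeps the band floor on `[t₁, τ)`
  have hfloor : ∀ t ∈ Ico t₁ τ, β * (r * x t 2) ≤ κ * x t 4 := by
    refine h.band_floor_of_level hκ0 hδ hr.le ht₁ hβ0.le hL ?_
      (fun t ht => (hc t ⟨ht₁.1.trans ht.1, ht.2⟩).2)
    have : κ * δ * (τ - t₁) ≤ κ * δ * T :=
      mul_le_mul_of_nonneg_left (by linarith [ht₁.1, hτT]) (mul_nonneg hκ0 hδ)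
    linarith
  -- Step 3: the restarted window at `t₁` and its angle
  have hS := h.shift ht₁
  have hmem : ∀ s ∈ Ico 0 (τ - t₁), t₁ + s ∈ Ico 0 τ := fun s hs =>
    ⟨by linarith [ht₁.1, hs.1], by linarith [hs.2]⟩
  have hmem' : ∀ s ∈ Icc 0 (τ - t₁), t₁ + s ∈ Icc 0 τ := fun s hs =>
    ⟨by linarith [ht₁.1, hs.1], by linarith [hs.2]⟩
  set Θ₁ : ℝ → ℝ := fun u => Θ (t₁ + u) - Θ t₁ with hΘ₁_def
  have hΘ₁0 : Θ₁ 0 = 0 := by simp [hΘ₁_def]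
  have hΘ₁c : ContinuousOn Θ₁ (Icc 0 (τ - t₁)) := by
    have hmaps : MapsTo (fun s : ℝ => t₁ + s) (Icc 0 (τ - t₁)) (Icc 0 τ) := fun s hs => hmem' s hs
    exact (hΘc.comp (continuous_const.add continuous_id).continuousOn hmaps).sub
      continuousOn_const
  have hΘ₁' : ∀ s ∈ Ico 0 (τ - t₁),
      HasDerivWithinAt Θ₁ (r * (fun u => x (t₁ + u)) s 2) (Ici s) s := fun s hs =>
    (SelfDampingRotor.hasDerivWithinAt_shift (hΘ' (t₁ + s) (hmem s hs))).sub_const _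
  have hΘt₁0 : 0 ≤ Θ t₁ := by
    have h1 := angle_ge_mul hr.le hΘ0 hΘc hΘ' (fun t ht => (hc t ht).1) t₁ ht₁
    have h2 : 0 ≤ r * c₀ * t₁ := by have := ht₁.1; have := hr.le; have := hc₀.le; positivity
    linarith
  have hΘ₁M : ∀ s ∈ Icc 0 (τ - t₁), Θ₁ s ≤ ΘM := by
    intro s hs
    have := hΘM (t₁ + s) (hmem' s hs)
    simp only [hΘ₁_def]
    linarith
  have hcS : ∀ s ∈ Ico 0 (τ - t₁), 0 ≤ (fun u => x (t₁ + u)) s 2 ∧ (fun u => x (t₁ + u)) s 2 ≤ Cm :=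
    fun s hs => by
      obtain ⟨h0, h1⟩ := hc (t₁ + s) (hmem s hs)
      exact ⟨hc₀.le.trans h0, h1⟩
  have hRS : ∀ s ∈ Ico 0 (τ - t₁), ∀ i, |(fun u => x (t₁ + u)) s i| ≤ R := fun s hs i =>
    hRall (t₁ + s) (hIcoIcc _ (hmem s hs)) i
  have hbandS : ∀ s ∈ Ico 0 (τ - t₁),
      β * (r * (fun u => x (t₁ + u)) s 2) ≤ κ * (fun u => x (t₁ + u)) s 4 ∧
        β * (κ * (fun u => x (t₁ + u)) s 4) ≤ 2 * (r * (fun u => x (t₁ + u)) s 2) := by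
    intro s hs
    have hts : t₁ + s ∈ Ico t₁ τ := ⟨by linarith [hs.1], by linarith [hs.2]⟩
    have hts' : t₁ + s ∈ Ico 0 τ := hmem s hs
    refine ⟨hfloor _ hts, ?_⟩
    have h4 : x (t₁ + s) 4 ≤ R := (le_abs_self _).trans (hRall _ (hIcoIcc _ hts') 4)
    have h5 : κ * x (t₁ + s) 4 ≤ κ * R := mul_le_mul_of_nonneg_left h4 hκ0
    have h6 : β * (κ * x (t₁ + s) 4) ≤ β * (κ * R) := mul_le_mul_of_nonneg_left h5 hβ0.le
    have h7 : 2 * (r * c₀) ≤ 2 * (r * x (t₁ + s) 2) := by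
      have h8 := mul_le_mul_of_nonneg_left (hc _ hts').1 hr.le
      linarith
    show β * (κ * x (t₁ + s) 4) ≤ 2 * (r * x (t₁ + s) 2)
    linarith
  have hdec := hS.pair_energy_decay_overdamped hε hσ hμ hr.le hδ hR hCm.le hβ0 hβ1 hlam0 hlam
    hΘ₁0 hΘ₁c hΘ₁' hΘ₁M hcS hRS hbandS
  -- Step 4: read off at a time `t` of large angle
  intro t ht hΘt
  have hΘt₁ : Θ t₁ ≤ r * Cm * TA := by
    have h1 := angle_le_mul hr.le hΘ0 hΘc hΘ' (fun s hs => (hc s hs).2) t₁ ht₁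
    have h2 : r * Cm * t₁ ≤ r * Cm * TA :=
      mul_le_mul_of_nonneg_left ht₁A.2 (mul_nonneg hr.le hCm.le)
    linarith
  have ht₁t : t₁ ≤ t := by
    by_contra hlt
    push Not at hlt
    have hm := angle_mono hr.le hΘc hΘ' (fun s hs => hc₀.le.trans (hc s hs).1) ht.1 hlt.le ht₁.2
    linarith
  have hsmem : t - t₁ ∈ Icc 0 (τ - t₁) := ⟨by linarith, by linarith [ht.2]⟩
  have hmain := hdec (t - t₁) hsmem
  have e1 : t₁ + (t - t₁) = t := by ring
  simp only [hΘ₁_def, e1, add_zero] at hmain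
  have hexp : Real.exp (-lam * (Θ t - Θ t₁)) ≤ Real.exp (-lam * Θd) := by
    apply Real.exp_le_exp.2
    have h1 : Θd ≤ Θ t - Θ t₁ := by linarith
    have h2 := mul_le_mul_of_nonneg_left h1 hlam0
    linarith
  have hpair₁ : x t₁ 0 ^ 2 + x t₁ 3 ^ 2 ≤ energy (x 0) + 10 * (δ * R) * T := by
    have hE := (abs_le.1 (h.energy_abs_sub_le hR (fun s hs => hRall s (hIcoIcc s hs)) t₁ ht₁)).2
    have he : energy (x t₁) =
        x t₁ 0 ^ 2 + x t₁ 1 ^ 2 + x t₁ 2 ^ 2 + x t₁ 3 ^ 2 + x t₁ 4 ^ 2 := by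
      rw [energy, Fin.sum_univ_five]
    have hdr : 10 * (δ * R) * t₁ ≤ 10 * (δ * R) * T :=
      mul_le_mul_of_nonneg_left (ht₁.2.trans hτT) (by positivity)
    rw [he] at hE
    linarith [sq_nonneg (x t₁ 1), sq_nonneg (x t₁ 2), sq_nonneg (x t₁ 4)]
  have hbr : (1 + β / 2) * (x t₁ 0 ^ 2 + x t₁ 3 ^ 2) +
      8 * R * (ε * R ^ 2 + σ * R * Cm + μ * Cm ^ 2 + δ) * Real.exp (lam * ΘM) * (t - t₁) ≤
      (1 + β / 2) * (energy (x 0) + 10 * (δ * R) * T) +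
      8 * R * (ε * R ^ 2 + σ * R * Cm + μ * Cm ^ 2 + δ) * Real.exp (lam * ΘM) * T := by
    have h1 := mul_le_mul_of_nonneg_left hpair₁ (by linarith : (0 : ℝ) ≤ 1 + β / 2)
    have h2 : 8 * R * (ε * R ^ 2 + σ * R * Cm + μ * Cm ^ 2 + δ) * Real.exp (lam * ΘM) *
        (t - t₁) ≤
        8 * R * (ε * R ^ 2 + σ * R * Cm + μ * Cm ^ 2 + δ) * Real.exp (lam * ΘM) * T :=
      mul_le_mul_of_nonneg_left (by linarith [ht.2, ht₁.1, hτT]) (by positivity)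
    linarith
  have hbr0 : 0 ≤ (1 + β / 2) * (x t₁ 0 ^ 2 + x t₁ 3 ^ 2) +
      8 * R * (ε * R ^ 2 + σ * R * Cm + μ * Cm ^ 2 + δ) * Real.exp (lam * ΘM) * (t - t₁) := by
    have : 0 ≤ t - t₁ := by linarith
    positivity
  calc (1 - β / 2) * (x t 0 ^ 2 + x t 3 ^ 2)
      ≤ Real.exp (-lam * (Θ t - Θ t₁)) * ((1 + β / 2) * (x t₁ 0 ^ 2 + x t₁ 3 ^ 2) +
          8 * R * (ε * R ^ 2 + σ * R * Cm + μ * Cm ^ 2 + δ) * Real.exp (lam * ΘM) *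
            (t - t₁)) := hmain
    _ ≤ Real.exp (-lam * Θd) * ((1 + β / 2) * (x t₁ 0 ^ 2 + x t₁ 3 ^ 2) +
          8 * R * (ε * R ^ 2 + σ * R * Cm + μ * Cm ^ 2 + δ) * Real.exp (lam * ΘM) *
            (t - t₁)) := mul_le_mul_of_nonneg_right hexp hbr0
    _ ≤ _ := mul_le_mul_of_nonneg_left hbr (Real.exp_pos _).le

/-- **The output is loaded past the conversion angle** (energy bookkeeping on top of
`pair_energy_le_of_angle`): with the clock side now asked on the CLOSED window,
`ã(t)² ≥ E(0) - 10RδT - B² - Cm² - exp(-λΘ_d)·(…)/(1 - β/2)` for every `t ∈ [0, τ]` with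
`Θ(t) ≥ r·Cm·T_A + Θ_d`. [folklore] -/
theorem output_sq_ge_of_angle (h : IsForcedWindow ε σ ν μ r κ δ τ x) (hε : 0 ≤ ε) (hσ : 0 ≤ σ)
    (hμ : 0 ≤ μ) (hr : 0 < r) (hκ : 0 < κ) (hδ : 0 ≤ δ)
    {R B Cm c₀ β lam ΘM u₀ L TA Θd T : ℝ} (hR : 0 ≤ R) (hCm : 0 < Cm)
    (hc₀ : 0 < c₀) (hβ0 : 0 < β) (hβ1 : β ≤ 1) (hlam0 : 0 ≤ lam) (hlam : lam ≤ β / 4)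
    (hu₀ : 0 ≤ u₀) (hΘd : 0 < Θd) (hτT : τ ≤ T) (hΘ0 : Θ 0 = 0) (hΘc : ContinuousOn Θ (Icc 0 τ))
    (hΘ' : ∀ t ∈ Ico 0 τ, HasDerivWithinAt Θ (r * x t 2) (Ici t) t)
    (hΘM : ∀ t ∈ Icc 0 τ, Θ t ≤ ΘM)
    (hc : ∀ t ∈ Icc 0 τ, c₀ ≤ x t 2 ∧ x t 2 ≤ Cm) (hRall : ∀ t ∈ Icc 0 τ, ∀ i, |x t i| ≤ R)
    (hBall : ∀ t ∈ Icc 0 τ, |x t 1| ≤ B) (hout : ∀ t ∈ Ico 0 τ, 0 ≤ x t 4)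
    (hLfloor : β * (r * Cm) + κ * δ * T ≤ L) (hLceil : L ≤ r * c₀)
    (hceil : β * (κ * R) ≤ 2 * (r * c₀))
    (hu₀E : u₀ ≤ energy (x 0) - 10 * (δ * R) * T - B ^ 2 - Cm ^ 2 - (L / κ) ^ 2)
    (hTA : TA ∈ Icc 0 τ)
    (hreach : L ≤ κ * (x 0 4 - κ / (r * Cm) * R ^ 2 +
      κ / (r * Cm) / 2 * ((1 - 1 / 2) * u₀) * (r * c₀ * TA) -
      (κ / (r * Cm) * R * (ε * R ^ 2 + σ * R * Cm + μ * Cm ^ 2 + δ) + δ) * TA)) :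
    ∀ t ∈ Icc 0 τ, r * Cm * TA + Θd ≤ Θ t →
      energy (x 0) - 10 * (δ * R) * T - B ^ 2 - Cm ^ 2 -
        Real.exp (-lam * Θd) * ((1 + β / 2) * (energy (x 0) + 10 * (δ * R) * T) +
          8 * R * (ε * R ^ 2 + σ * R * Cm + μ * Cm ^ 2 + δ) * Real.exp (lam * ΘM) * T) /
          (1 - β / 2) ≤ x t 4 ^ 2 := by
  intro t ht hΘt
  have hIcoIcc : ∀ t ∈ Ico 0 τ, t ∈ Icc 0 τ := fun t ht => Ico_subset_Icc_self ht
  have hpair := h.pair_energy_le_of_angle hε hσ hμ hr hκ hδ hR hCm hc₀ hβ0 hβ1 hlam0 hlam hu₀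
    hΘd hτT hΘ0 hΘc hΘ' hΘM (fun s hs => hc s (hIcoIcc s hs)) hRall
    (fun s hs => hBall s (hIcoIcc s hs)) hout hLfloor hLceil hceil hu₀E hTA hreach t ht hΘt
  have hm : 0 < 1 - β / 2 := by linarith
  have hE := (abs_le.1 (h.energy_abs_sub_le hR (fun s hs => hRall s (hIcoIcc s hs)) t ht)).1
  have he : energy (x t) = x t 0 ^ 2 + x t 1 ^ 2 + x t 2 ^ 2 + x t 3 ^ 2 + x t 4 ^ 2 := by
    rw [energy, Fin.sum_univ_five]
  have hb2 : x t 1 ^ 2 ≤ B ^ 2 := by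
    have hb := abs_le.1 (hBall t ht); exact sq_le_sq' hb.1 hb.2
  have hc2 : x t 2 ^ 2 ≤ Cm ^ 2 := by
    obtain ⟨h0, h1⟩ := hc t ht
    exact pow_le_pow_left₀ (hc₀.le.trans h0) h1 2
  have hdr : 10 * (δ * R) * t ≤ 10 * (δ * R) * T :=
    mul_le_mul_of_nonneg_left (ht.2.trans hτT) (by positivity)
  have hdiv : x t 0 ^ 2 + x t 3 ^ 2 ≤
      Real.exp (-lam * Θd) * ((1 + β / 2) * (energy (x 0) + 10 * (δ * R) * T) +
        8 * R * (ε * R ^ 2 + σ * R * Cm + μ * Cm ^ 2 + δ) * Real.exp (lam * ΘM) * T) /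
        (1 - β / 2) := by
    rw [le_div_iff₀ hm]
    linarith
  linarith

end IsForcedWindow

end Literature.Analysis.FluidPDE.FluidComputer

end
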